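import Summits.QuantumAdvantage.AdviceFreeQNC0.DominationCertificate
import HarnessLib

/-!
# Cell qa-qnc0 (rung F-Q1, density axis): the DISJOINT DOMINATION CERTIFICATES at `m = 5` and `m = 6`
# (`domFive : DomFive`, `domSix : DomSix`; Sketch13 v6e, planner qa-qnc0-p1 ROUND-12 §2.10 (xi-q),
# kit13/domcert_m5.txt, kit13/domcert_m6.txt; checker `DominationCertificate.lean`)

`K0 = [1 ≤ |u| ≤ 4]` is a codeword of `C_m` for `m ≤ 6` (triple `T₀ = parity`, `T₁ = 1`, `T₂ = 1 + parity`;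
`isElim1_K14`).  At `m = 5` (`Z = {0⁵, 1⁵}`, `w(5,1) = 2`) and `m = 6` (`Z = {|u| ∈ {0,5,6}}`, `w(6,1) = 8`)
the planner's tables (`table5`, `table6`: one 6-point outside relation per inside point) pass the three finite
checks of `DomCert` by `decide +kernel`, whence OPTIMALITY (`isOpt1_five`, `isOpt1_six`), **`domFive : DomFive`**,
**`domSix : DomSix`**, and the mass inequality `MassIneqK m k K0` at EVERY level `k` (`massIneqK_five`,
`massIneqK_six`, via `domPays`).

WHAT THIS IS NOT: `m = 5, 6` do not pay (`2/32`, `8/64 < 1/4`) and `W_k(m,1) = w^k` is LP-forced there anyway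
(planner 12:08Z); the content is the LP-free certificate for the mass inequality itself.  `MassIneqKPays` is
not proved here; MULT₁ at paying block sizes is OPEN; separation NOT moved.
-/

namespace Summit.QuantumAdvantage.AdviceFreeQNC0

open Finset
open Literature.Computability.MetaComplexity Literature.Computability.MetaComplexity.Smolensky

namespace MassInequality


namespace DomSmall

/-- The optimal codeword at `m = 5, 6`: `K0(u) = [1 ≤ |u| ≤ 4]`. -/
def K14 (m : ℕ) (u : Fin m → Bool) : Bool := decide (1 ≤ wt u ∧ wt u ≤ 4)

/-- Its triple: `T₀ = parity`, `T₁ = 1`, `T₂ = 1 + parity`. -/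
def T14 (m : ℕ) (r : ℕ) (u : Fin m → Bool) : Bool :=
  if r = 0 then decide (wt u % 2 = 1) else if r = 1 then true else !decide (wt u % 2 = 1)

/-- Parity has `𝔽₂`-degree `1`: its indicator is `Σ_i x_i`. -/
theorem hasDeg_parity (m : ℕ) : HasDeg (fun u : Fin m → Bool => decide (wt u % 2 = 1)) 1 := by
  unfold HasDeg
  have heq : (fun x : Fin m → Bool => if decide (wt x % 2 = 1) = true then (1 : ZMod 2) else 0) =
      ∑ i : Fin m, mono (ZMod 2) {i} := by
    funext x
    rw [Finset.sum_apply]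
    have h1 : ∀ i : Fin m, mono (ZMod 2) {i} x = if x i = true then 1 else 0 := fun i => by
      rw [mono_apply]; simp
    simp only [h1]
    rw [← Finset.sum_filter, sum_const, nsmul_eq_mul, mul_one]
    unfold wt
    rcases Nat.mod_two_eq_zero_or_one ((univ.filter fun i : Fin m => x i = true).card) with h | h
    · rw [h]
      have : (((univ.filter fun i : Fin m => x i = true).card : ℕ) : ZMod 2) = 0 :=
        (ZMod.natCast_eq_zero_iff_even).2 (Nat.even_iff.2 h)
      rw [this]; simp
    · rw [h]
      have : (((univ.filter fun i : Fin m => x i = true).card : ℕ) : ZMod 2) = 1 :=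
        (ZMod.natCast_eq_one_iff_odd).2 (Nat.odd_iff.2 h)
      rw [this]; simp
  rw [heq]
  exact Submodule.sum_mem _ fun i _ => mono_mem_lowDeg (by simp)

/-- The constant `true` has degree `≤ 1`. -/
theorem hasDeg_true (m : ℕ) : HasDeg (fun _ : Fin m → Bool => true) 1 := by
  unfold HasDeg
  have : (fun _ : Fin m → Bool => if true = true then (1 : ZMod 2) else 0) = mono (ZMod 2) (∅ : Finset (Fin m)) := by
    funext x; simp
  rw [this]; exact mono_mem_lowDeg (by simp)

/-- `1 + parity` has degree `1`. -/
theorem hasDeg_not_parity (m : ℕ) : HasDeg (fun u : Fin m → Bool => !decide (wt u % 2 = 1)) 1 := by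
  have h := hasDeg_xor (hasDeg_parity m) (hasDeg_true m)
  have heq : (fun u : Fin m → Bool => !decide (wt u % 2 = 1)) =
      fun u => xor (decide (wt u % 2 = 1)) true := by
    funext u; cases decide (wt u % 2 = 1) <;> rfl
  rw [heq]; exact h

/-- `K0 = [1 ≤ |u| ≤ 4] ∈ C_m` for `m ≤ 6`. -/
theorem isElim1_K14 {m : ℕ} (hm : m ≤ 6) : IsElim1 m (K14 m) := by
  refine ⟨T14 m, fun r => ?_, fun u => ?_, fun u => ?_⟩
  · unfold T14
    by_cases h0 : r = 0
    · simp only [h0, if_true]; exact hasDeg_parity m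
    · by_cases h1 : r = 1
      · simp only [h1, if_true, show (1 : ℕ) ≠ 0 from one_ne_zero, if_false]; exact hasDeg_true m
      · simp only [h0, h1, if_false]; exact hasDeg_not_parity m
  · unfold T14
    simp only [if_true, show (1 : ℕ) ≠ 0 from one_ne_zero, if_false, show (2 : ℕ) ≠ 0 from two_ne_zero,
      show (2 : ℕ) ≠ 1 from by norm_num]
    cases decide (wt u % 2 = 1) <;> rfl
  · -- `K0 u = T14 (|u| mod 3) u`: a function of `|u| ≤ m ≤ 6` only
    unfold K14 T14
    have h6 : wt u ≤ 6 := by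
      have : wt u ≤ m := by unfold wt; exact (card_le_univ _).trans (by simp)
      omega
    generalize wt u = w at h6
    interval_cases w <;> simp

/-- The certificate at `m = 5` (kit13/domcert_m5.txt): the 2 inside points with their 6-point relations. -/
def table5 : List ((Fin 5 → Bool) × List (Fin 5 → Bool)) := [
  (![false, false, false, false, false], [![false, false, false, false, true], ![false, false, false, true, false], ![false, false, true, true, true], ![false, true, false, true, true], ![false, true, true, false, false], ![false, true, true, true, true]]),
  (![true, true, true, true, true], [![false, false, false, true, true], ![false, false, true, false, false], ![false, true, true, false, true], ![true, false, false, false, true], ![true, false, true, true, true], ![true, true, true, true, false]])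
]

/-- The certificate at `m = 6` (kit13/domcert_m6.txt): the 8 inside points with their 6-point relations. -/
def table6 : List ((Fin 6 → Bool) × List (Fin 6 → Bool)) := [
  (![false, false, false, false, false, false], [![false, false, true, true, true, true], ![false, true, false, false, true, false], ![true, false, false, true, true, false], ![true, false, false, true, true, true], ![true, true, false, true, false, false], ![true, true, true, false, true, false]]),
  (![false, true, true, true, true, true], [![false, false, false, true, false, false], ![false, false, true, true, false, false], ![false, true, true, false, true, true], ![true, false, false, false, true, true], ![true, true, false, false, false, false], ![true, true, true, true, false, false]]),
  (![true, false, true, true, true, true], [![false, false, true, false, false, false], ![false, true, false, true, true, true], ![true, false, false, false, false, true], ![true, false, false, true, false, false], ![true, false, true, false, true, false], ![true, true, false, true, false, true]]),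
  (![true, true, false, true, true, true], [![false, false, false, false, false, true], ![false, false, true, false, false, true], ![false, true, true, true, false, false], ![true, false, false, false, true, false], ![true, false, true, false, true, true], ![true, true, false, true, true, false]]),
  (![true, true, true, false, true, true], [![false, false, false, false, true, true], ![false, false, true, true, true, false], ![false, true, false, true, true, false], ![false, true, true, false, false, false], ![true, false, false, false, false, false], ![true, true, true, false, false, false]]),
  (![true, true, true, true, false, true], [![false, true, false, false, false, false], ![false, true, true, true, true, false], ![true, false, false, true, false, true], ![true, false, true, false, false, true], ![true, true, false, false, false, true], ![true, true, false, false, true, true]]),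
  (![true, true, true, true, true, false], [![false, false, false, false, true, false], ![false, false, false, true, true, false], ![false, false, true, false, true, false], ![false, true, true, true, false, true], ![true, false, true, true, false, true], ![true, true, false, false, true, false]]),
  (![true, true, true, true, true, true], [![false, false, false, true, false, true], ![false, true, false, false, true, true], ![false, true, false, true, false, false], ![false, true, false, true, false, true], ![true, false, true, false, false, false], ![true, true, true, false, false, true]])
]

/-- `m = 5`: check 1. -/
theorem listsOK_five : DomCert.ListsOK (K14 5) table5 := by
  unfold DomCert.ListsOK DomCert.Rl K14 wt table5
  decide +kernel

/-- `m = 5`: check 2. -/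
theorem sepOK_five : DomCert.SepOK (K14 5) table5 := by
  unfold DomCert.SepOK DomCert.Rl K14 wt table5
  decide +kernel

/-- `m = 5`: check 3. -/
theorem gensOK_five : DomCert.GensOK (K14 5) table5 := by
  unfold DomCert.GensOK DomCert.patZ DomCert.Rl K14 mono wt table5
  decide +kernel

/-- `m = 5`: `failCount K0 = 2 = w(5,1)`. -/
theorem failCount_five : failCount (K14 5) = 2 := by
  unfold failCount K14 wt; decide +kernel

/-- `m = 6`: check 1. -/
theorem listsOK_six : DomCert.ListsOK (K14 6) table6 := by
  unfold DomCert.ListsOK DomCert.Rl K14 wt table6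
  decide +kernel

/-- `m = 6`: check 2. -/
theorem sepOK_six : DomCert.SepOK (K14 6) table6 := by
  unfold DomCert.SepOK DomCert.Rl K14 wt table6
  decide +kernel

/-- `m = 6`: check 3. -/
theorem gensOK_six : DomCert.GensOK (K14 6) table6 := by
  unfold DomCert.GensOK DomCert.patZ DomCert.Rl K14 mono wt table6
  decide +kernel

/-- `m = 6`: `failCount K0 = 8 = w(6,1)`. -/
theorem failCount_six : failCount (K14 6) = 8 := by
  unfold failCount K14 wt; decide +kernel

/-- `K0` is optimal at `m = 5` (every codeword of `C_5` has `≥ 2` zeros). -/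
theorem isOpt1_five : IsOpt1 5 (K14 5) :=
  DomCert.isOpt1_of (isElim1_K14 (by norm_num)) listsOK_five sepOK_five gensOK_five

/-- `K0` is optimal at `m = 6` (every codeword of `C_6` has `≥ 8` zeros). -/
theorem isOpt1_six : IsOpt1 6 (K14 6) :=
  DomCert.isOpt1_of (isElim1_K14 (by norm_num)) listsOK_six sepOK_six gensOK_six

end DomSmall

/-- **`DomFive` — PROVED** (the disjoint domination certificate at `m = 5`, with the optimality of `K0`). -/
theorem domFive : DomFive :=
  ⟨DomSmall.K14 5, DomSmall.isOpt1_five, DomSmall.failCount_five,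
    DomCert.disjointDom_of DomSmall.listsOK_five DomSmall.sepOK_five DomSmall.gensOK_five⟩

/-- **`DomSix` — PROVED** (the disjoint domination certificate at `m = 6`, with the optimality of `K0`). -/
theorem domSix : DomSix :=
  ⟨DomSmall.K14 6, DomSmall.isOpt1_six, DomSmall.failCount_six,
    DomCert.disjointDom_of DomSmall.listsOK_six DomSmall.sepOK_six DomSmall.gensOK_six⟩

/-- Hence the mass inequality holds at `m = 5` at EVERY level, for the optimal codeword `K0`. -/
theorem massIneqK_five : ∀ k, 0 < k → MassIneqK 5 k (DomSmall.K14 5) :=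
  DomCert.massIneqK_of DomSmall.listsOK_five DomSmall.sepOK_five DomSmall.gensOK_five

/-- Hence the mass inequality holds at `m = 6` at EVERY level, for the optimal codeword `K0`. -/
theorem massIneqK_six : ∀ k, 0 < k → MassIneqK 6 k (DomSmall.K14 6) :=
  DomCert.massIneqK_of DomSmall.listsOK_six DomSmall.sepOK_six DomSmall.gensOK_six

end MassInequality

end Summit.QuantumAdvantage.AdviceFreeQNC0
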